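import Summits.QuantumFields.YangMills.Theses.TransportFieldFano
import Summits.QuantumFields.YangMills.Theorems.AdjointLoopFanoDirichletKinematic
import Summits.QuantumFields.YangMills.Theorems.FemtoTransferGapBounds
import HarnessLib

/-!
# `TransportFieldFano.Assembly` (item stmt-QuantumFields-23363, rev 1) — PROVED:
# (∃-window Fano floor) → AdjointLoopDirichletWeak → FirstLevelPolyTail → ThermalTraceWindow.SubFemtoFirstLevel

Route `TransportFieldFano` (D-0145 LINE g17-A of seat ym-idea-4; draft-by-design onto the leaf K2a = `ThermalTraceWindow.SubFemtoFirstLevel`).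
Adaptation of the landed `AdjointLoopFano.assembly_proof` (p732063) to the ∃-window floor and the polynomial volume loss `L^k` of the Dirichlet
ceiling:

* from the floor take `(a, q)` (`2/3 < q < 1`) and its `∀M`-window; from `AdjointLoopDirichletWeak` take `k`, WLOG `k' = max k 0 ≥ 0`, and
  at `ε := (1 − q)/3` the constants `(C, β₂)`; put `C' := max C 1`, `M := 4C'`, `a_eff := min a ((1 − q)/(3(k'+1)))`;
* window `L ≤ β^{a_eff}` (so `L ≤ β^a` and `L^{k'+1} ≤ β^{(1−q)/3}`): in the exact `l2`-normalised vacuum `Ω` (`PhysL2.exists_groundState`) the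
  single-mode door `Deficit.pow_secondValue_ge_deficit` (`m = 1`, multiplier `F = flowLift 0 d`, physical by `isPhys_adjLoop`) gives
  `λ₀Var − D₁ ≤ λ₁Var`; the ceiling and the floor give `D₁ ≤ C'β^{ε−1}L^{k'}λ₀m₁` and `4C'β^{−q}m₁ ≤ Var`, the window gives
  `β^{ε−1}L^{k'}·L ≤ β^{−q}`, whence (`door_endgame`, using `m₁ ≥ 0` as `F ≥ 0`) `D₁ ≤ λ₀Var/(4L)`, `λ₁ ≥ λ₀(1 − 1/(4L))`, Bernoulli
  `λ₁^L ≥ (3/4)λ₀^L ≥ β^{−1}λ₀^L`;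
* tail `β^{a_eff} ≤ L ≤ β^A`: `FirstLevelPolyTail` at `(a_eff, A)`; uniform exponent `max k₃ 1`.

HONEST FRAMING: bookkeeping; the cruxes of the route, K2a, R2ξ″ and every summit statement remain OPEN; the YM mass gap is NOT proved.
No `sorry`, no new axiom, no new definition.  References: [cite: ReedSimonIV1978, Thm. XIII.1]; [cite: Luscher1983, §3].
-/

set_option autoImplicit false

noncomputable section

open MeasureTheory Filter Topology Real
open Literature.MathematicalPhysics.QuantumFieldTheory (GaugeConfig Site gaugeTransform wilsonFlow)
open Literature.MathematicalPhysics.QuantumLattice (fundamentalRep_apply)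

namespace Summit.QuantumFields.YangMills.Theorems.TransportFieldFano

open Summit.QuantumFields.YangMills.Theorems.FemtoTransferGap
open Summit.QuantumFields.YangMills.Theorems.AdjointLoopFano

/-! ## §1 Real-arithmetic helpers -/

/-- Window bookkeeping: for `β ≥ 1`, `q ≤ 1`, `1 ≤ L ≤ β^{a₁}`, `0 ≤ k'`, `a₁·(k'+1) ≤ (1−q)/3` and `ε = (1−q)/3`:
`β^{ε−1} · L^{k'} · L ≤ β^{−q}`. [folklore] -/
theorem window_pow_le {β a₁ q k' : ℝ} {Lr : ℝ} (hβ : 1 ≤ β) (hq : q ≤ 1) (hL1 : 1 ≤ Lr) (hLa : Lr ≤ β ^ a₁)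
    (hk' : 0 ≤ k') (hak : a₁ * (k' + 1) ≤ (1 - q) / 3) :
    β ^ ((1 - q) / 3 - 1) * Lr ^ k' * Lr ≤ β ^ (-q) := by
  have hβ0 : 0 < β := by linarith
  have hL0 : 0 < Lr := by linarith
  have h1 : Lr ^ k' * Lr = Lr ^ (k' + 1) := by
    rw [Real.rpow_add hL0, Real.rpow_one]
  have h2 : Lr ^ (k' + 1) ≤ (β ^ a₁) ^ (k' + 1) :=
    Real.rpow_le_rpow hL0.le hLa (by linarith)
  have h3 : (β ^ a₁) ^ (k' + 1) = β ^ (a₁ * (k' + 1)) := by rw [← Real.rpow_mul hβ0.le]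
  have h4 : β ^ (a₁ * (k' + 1)) ≤ β ^ ((1 - q) / 3) := Real.rpow_le_rpow_of_exponent_le hβ hak
  have hLk : Lr ^ k' * Lr ≤ β ^ ((1 - q) / 3) := by rw [h1]; exact h2.trans (h3 ▸ h4)
  calc β ^ ((1 - q) / 3 - 1) * Lr ^ k' * Lr = β ^ ((1 - q) / 3 - 1) * (Lr ^ k' * Lr) := by ring
    _ ≤ β ^ ((1 - q) / 3 - 1) * β ^ ((1 - q) / 3) :=
        mul_le_mul_of_nonneg_left hLk (Real.rpow_nonneg hβ0.le _)
    _ = β ^ ((1 - q) / 3 - 1 + (1 - q) / 3) := by rw [← Real.rpow_add hβ0]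
    _ ≤ β ^ (-q) := Real.rpow_le_rpow_of_exponent_le hβ (by linarith)

/-- **The single-mode endgame** (pure real arithmetic): from the door `T·V − D ≤ S·V`, the ceiling `D ≤ C'(X·T·m₁)`, the window
`X·L ≤ Y`, the floor `4C'·Y·m₁ ≤ V` (`V > 0`, `m₁ ≥ 0`, `T > 0`, `C' ≥ 1`, `L ≥ 1`, `β ≥ 2`): `β^{−1} T^L ≤ S^L`. [cite: ReedSimonIV1978, Thm. XIII.1] -/
theorem door_endgame {T S V D m₁ C' X Y β : ℝ} {L : ℕ} (hL : 1 ≤ L) (hT : 0 < T) (hV : 0 < V) (hm : 0 ≤ m₁) (hC' : 1 ≤ C')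
    (hβ : 2 ≤ β) (hdoor : T * V - D ≤ S * V) (hD : D ≤ C' * (X * T * m₁)) (hwin : X * L ≤ Y) (hV1 : 4 * C' * Y * m₁ ≤ V) :
    β ^ (-(1 : ℝ)) * T ^ L ≤ S ^ L := by
  have hL1 : (1 : ℝ) ≤ L := by exact_mod_cast hL
  have hLpos : (0 : ℝ) < L := by linarith
  have hβpos : 0 < β := by linarith
  have hCTm : 0 ≤ C' * T * m₁ := by
    have : 0 ≤ C' := by linarith
    positivity
  have hDL : D * L ≤ T * V / 4 := by
    calc D * L ≤ C' * (X * T * m₁) * L := mul_le_mul_of_nonneg_right hD hLpos.le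
      _ = C' * T * m₁ * (X * L) := by ring
      _ ≤ C' * T * m₁ * Y := mul_le_mul_of_nonneg_left hwin hCTm
      _ = T * (4 * C' * Y * m₁) / 4 := by ring
      _ ≤ T * V / 4 := by
        have := mul_le_mul_of_nonneg_left hV1 hT.le
        linarith
  have hS : T * (1 - 1 / (4 * (L : ℝ))) ≤ S := by
    have h3 : D ≤ T * V / (4 * L) := by
      rw [le_div_iff₀ (by positivity)]
      calc D * (4 * L) = D * L * 4 := by ring
        _ ≤ T * V / 4 * 4 := mul_le_mul_of_nonneg_right hDL (by norm_num)
        _ = T * V := by ring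
    have h1 : T * V - T * V / (4 * L) ≤ S * V := by linarith
    have h2 : T * (1 - 1 / (4 * (L : ℝ))) * V ≤ S * V := by
      have : T * (1 - 1 / (4 * (L : ℝ))) * V = T * V - T * V / (4 * L) := by field_simp
      rw [this]; exact h1
    exact le_of_mul_le_mul_right h2 hV
  have hq0 : 0 ≤ 1 - 1 / (4 * (L : ℝ)) := by
    have : 1 / (4 * (L : ℝ)) ≤ 1 / 4 := by
      apply div_le_div_of_nonneg_left (by norm_num) (by norm_num); linarith
    linarith
  have hTS0 : 0 ≤ T * (1 - 1 / (4 * (L : ℝ))) := mul_nonneg hT.le hq0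
  have hSL : (T * (1 - 1 / (4 * (L : ℝ)))) ^ L ≤ S ^ L := pow_le_pow_left₀ hTS0 hS L
  have hBern : (3 : ℝ) / 4 ≤ (1 - 1 / (4 * (L : ℝ))) ^ L := by
    have h : (-2 : ℝ) ≤ -(1 / (4 * (L : ℝ))) := by
      have : 1 / (4 * (L : ℝ)) ≤ 1 / 4 := by
        apply div_le_div_of_nonneg_left (by norm_num) (by norm_num); linarith
      linarith
    have hb := one_add_mul_le_pow h L
    have h34 : 1 + (L : ℝ) * -(1 / (4 * (L : ℝ))) = 3 / 4 := by field_simp; ring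
    rw [h34] at hb
    have h1 : (1 : ℝ) + -(1 / (4 * (L : ℝ))) = 1 - 1 / (4 * (L : ℝ)) := by ring
    rw [h1] at hb
    exact hb
  have hB : (3 : ℝ) / 4 * T ^ L ≤ (T * (1 - 1 / (4 * (L : ℝ)))) ^ L := by
    rw [mul_pow, mul_comm]
    exact mul_le_mul_of_nonneg_left hBern (pow_nonneg hT.le L)
  have hβinv : β ^ (-(1 : ℝ)) ≤ 3 / 4 := by
    rw [Real.rpow_neg_one, inv_le_comm₀ hβpos (by norm_num)]
    linarith
  calc β ^ (-(1 : ℝ)) * T ^ L ≤ 3 / 4 * T ^ L := mul_le_mul_of_nonneg_right hβinv (pow_nonneg hT.le L)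
    _ ≤ (T * (1 - 1 / (4 * (L : ℝ)))) ^ L := hB
    _ ≤ S ^ L := hSL

/-- `0 ≤ m₁ = ⟨FΩ, Ω⟩` since `F = flowLift 0 d ≥ 0` pointwise. [folklore] -/
theorem l2_adjLoop_mul_nonneg {L : ℕ} [NeZero L] (Ω : GaugeConfig 3 L SU2 → ℝ) :
    0 ≤ l2 (fun U => flowLift 0 (fun u : GaugeConfig 3 1 SU2 =>
      4 - ((su2Rep (u ((0 : Site 3 1), (0 : Fin 3)))).trace.re) ^ 2) U * Ω U) Ω := by
  unfold l2
  refine integral_nonneg fun U => ?_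
  have hF0 : 0 ≤ flowLift 0 (fun u : GaugeConfig 3 1 SU2 => 4 - ((su2Rep (u ((0 : Site 3 1), (0 : Fin 3)))).trace.re) ^ 2) U := by
    rw [flowLift_eq]
    refine div_nonneg (Finset.sum_nonneg fun x _ => ?_) (Nat.cast_nonneg _)
    have h1 := re_trace_le_two ((polyakovSite x (wilsonFlow 0 U)) ((0 : Site 3 1), (0 : Fin 3)))
    have h2 := neg_two_le_re_trace ((polyakovSite x (wilsonFlow 0 U)) ((0 : Site 3 1), (0 : Fin 3)))
    rw [fundamentalRep_apply]
    nlinarith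
  have : flowLift 0 (fun u : GaugeConfig 3 1 SU2 => 4 - ((su2Rep (u ((0 : Site 3 1), (0 : Fin 3)))).trace.re) ^ 2) U * Ω U * Ω U =
      flowLift 0 (fun u : GaugeConfig 3 1 SU2 => 4 - ((su2Rep (u ((0 : Site 3 1), (0 : Fin 3)))).trace.re) ^ 2) U * Ω U ^ 2 := by
    ring
  rw [this]
  exact mul_nonneg hF0 (sq_nonneg _)

/-! ## §2 The Assembly -/

/-- ★ **Assembly of route `TransportFieldFano`** (item stmt-QuantumFields-23363, rev 1): the ∃-window Fano floor, the `L^k`-lossy Dirichlet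
ceiling and the polynomial tail give K2a. [cite: ReedSimonIV1978, Thm. XIII.1] [cite: Luscher1983, §3] -/
theorem assembly_proof : Summit.QuantumFields.YangMills.Theses.TransportFieldFano.Assembly := by
  intro hFano hWeak hTail A hA
  obtain ⟨a, q, ha, _ha23, _hq23, hq1, _haq, hM⟩ := hFano
  obtain ⟨k, hk⟩ := hWeak
  set k' : ℝ := max k 0 with hk'_def
  have hk'0 : 0 ≤ k' := le_max_right _ _
  have hε : 0 < (1 - q) / 3 := by linarith
  obtain ⟨C, β₂, hC⟩ := hk ((1 - q) / 3) hε
  set C' : ℝ := max C 1 with hC'_def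
  have hC'1 : 1 ≤ C' := le_max_right _ _
  have hCC' : C ≤ C' := le_max_left _ _
  obtain ⟨β₁, L₁, hV⟩ := hM (4 * C')
  set a₁ : ℝ := min a ((1 - q) / (3 * (k' + 1))) with ha₁_def
  have ha₁pos : 0 < a₁ := lt_min ha (div_pos (by linarith) (by positivity))
  have ha₁a : a₁ ≤ a := min_le_left _ _
  have hak : a₁ * (k' + 1) ≤ (1 - q) / 3 := by
    have h1 : a₁ ≤ (1 - q) / (3 * (k' + 1)) := min_le_right _ _
    have h2 : 0 < k' + 1 := by linarith
    calc a₁ * (k' + 1) ≤ (1 - q) / (3 * (k' + 1)) * (k' + 1) := mul_le_mul_of_nonneg_right h1 h2.le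
      _ = (1 - q) / 3 := by field_simp
  obtain ⟨k₃, β₃, L₃, hT⟩ := hTail a₁ ha₁pos A hA
  refine ⟨max k₃ 1, max (max β₁ β₂) (max β₃ 2), max L₁ L₃, ?_⟩
  intro β hβ L _ hL hLA
  have hβ₁ : β₁ ≤ β := le_trans (le_trans (le_max_left _ _) (le_max_left _ _)) hβ
  have hβ₂ : β₂ ≤ β := le_trans (le_trans (le_max_right _ _) (le_max_left _ _)) hβ
  have hβ₃ : β₃ ≤ β := le_trans (le_trans (le_max_left _ _) (le_max_right _ _)) hβ
  have hβ2 : (2 : ℝ) ≤ β := le_trans (le_trans (le_max_right _ _) (le_max_right _ _)) hβ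
  have hβ1 : (1 : ℝ) ≤ β := by linarith
  have hβpos : 0 < β := by linarith
  have hL₁ : L₁ ≤ L := le_trans (le_max_left _ _) hL
  have hL₃ : L₃ ≤ L := le_trans (le_max_right _ _) hL
  have hLone : 1 ≤ L := NeZero.one_le
  have hL1 : (1 : ℝ) ≤ L := by exact_mod_cast hLone
  have hk1 : β ^ (-(max k₃ 1)) ≤ β ^ (-(1 : ℝ)) := Real.rpow_le_rpow_of_exponent_le hβ1 (neg_le_neg (le_max_right _ _))
  have hk3 : β ^ (-(max k₃ 1)) ≤ β ^ (-k₃) := Real.rpow_le_rpow_of_exponent_le hβ1 (neg_le_neg (le_max_left _ _))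
  have hT0 : 0 < topValue su2Rep L β := topValue_su2Rep_pos L β
  have hpow0 : 0 ≤ levelValue su2Rep L β 0 ^ L := by
    rw [levelValue_zero]; exact pow_nonneg hT0.le L
  by_cases hcase : (L : ℝ) ≤ β ^ a₁
  · -- ### the window `L ≤ β^{a_eff}`
    have hLa : (L : ℝ) ≤ β ^ a := hcase.trans (Real.rpow_le_rpow_of_exponent_le hβ1 ha₁a)
    obtain ⟨Ω, θ, c, hΩ, -, -, hn, heig, -, -, -⟩ := PhysL2.exists_groundState (L := L) β
    have hF : IsPhys (flowLift (L := L) 0 (fun u : GaugeConfig 3 1 SU2 =>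
        4 - ((su2Rep (u ((0 : Site 3 1), (0 : Fin 3)))).trace.re) ^ 2)) := isPhys_adjLoop
    obtain ⟨CF, hCF⟩ := hF.bounded
    have hdoor := Deficit.pow_secondValue_ge_deficit hβpos hF.measurable hCF hF.gaugeInv hF.zeroFlux hΩ hn heig
      (m := 1) le_rfl
    simp only [pow_one, Function.iterate_one] at hdoor
    have hD := hC β hβ₂ L Ω hΩ hn heig
    dsimp only at hD
    obtain ⟨hV1, hV2⟩ := hV β hβ₁ L hL₁ hLa Ω hΩ hn heig
    have hm0 := l2_adjLoop_mul_nonneg (L := L) Ω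
    have hwin := window_pow_le hβ1 hq1.le hL1 hcase hk'0 hak
    -- ceiling with `C'` and `L^{k'}`
    have hLk : (L : ℝ) ^ k ≤ (L : ℝ) ^ k' := Real.rpow_le_rpow_of_exponent_le hL1 (le_max_left _ _)
    have hβe0 : 0 ≤ β ^ ((1 - q) / 3 - 1) := Real.rpow_nonneg hβpos.le _
    rw [levelValue_zero, levelValue_one]
    refine (mul_le_mul_of_nonneg_right hk1 (pow_nonneg hT0.le L)).trans ?_
    refine door_endgame (X := β ^ ((1 - q) / 3 - 1) * (L : ℝ) ^ k') (Y := β ^ (-q)) hLone hT0 hV2 hm0 hC'1 hβ2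
      hdoor ?_ hwin hV1
    -- `D ≤ C' (X T m₁)`
    have h0 : 0 ≤ β ^ ((1 - q) / 3 - 1) * (L : ℝ) ^ k * topValue su2Rep L β *
        l2 (fun U => flowLift 0 (fun u : GaugeConfig 3 1 SU2 =>
          4 - ((su2Rep (u ((0 : Site 3 1), (0 : Fin 3)))).trace.re) ^ 2) U * Ω U) Ω := by positivity
    have h2 : β ^ ((1 - q) / 3 - 1) * (L : ℝ) ^ k * topValue su2Rep L β *
        l2 (fun U => flowLift 0 (fun u : GaugeConfig 3 1 SU2 =>
          4 - ((su2Rep (u ((0 : Site 3 1), (0 : Fin 3)))).trace.re) ^ 2) U * Ω U) Ω ≤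
        β ^ ((1 - q) / 3 - 1) * (L : ℝ) ^ k' * topValue su2Rep L β *
        l2 (fun U => flowLift 0 (fun u : GaugeConfig 3 1 SU2 =>
          4 - ((su2Rep (u ((0 : Site 3 1), (0 : Fin 3)))).trace.re) ^ 2) U * Ω U) Ω :=
      mul_le_mul_of_nonneg_right (mul_le_mul_of_nonneg_right (mul_le_mul_of_nonneg_left hLk hβe0) hT0.le) hm0
    nlinarith [hD, h2, mul_le_mul_of_nonneg_right hCC' h0, hC'1]
  · -- ### the tail `β^{a_eff} ≤ L ≤ β^A`
    have hge : β ^ a₁ ≤ (L : ℝ) := (not_le.mp hcase).le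
    have h := hT β hβ₃ L hL₃ hge hLA
    calc β ^ (-(max k₃ 1)) * levelValue su2Rep L β 0 ^ L ≤ β ^ (-k₃) * levelValue su2Rep L β 0 ^ L :=
          mul_le_mul_of_nonneg_right hk3 hpow0
      _ ≤ levelValue su2Rep L β 1 ^ L := h

end Summit.QuantumFields.YangMills.Theorems.TransportFieldFano

end
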